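import Literature.NumberTheory.GaloisRepresentations.RamificationFiltrationHerbrandQuotientProofs
import HarnessLib

/-!
# The cyclic totally ramified case of Hasse–Arf, I: principal units, norms, and Serre's Lemma V.9

`HasseArfReductionProofs.lean` reduces the Hasse–Arf theorem
(`Literature.NumberTheory.GaloisRepresentations.hasseArf`) to Serre's Prop. V.11 (*Local Fields*,
Ch. V §7): for a cyclic, totally ramified extension, `φ(μ)` is an integer at the last lower jump
`μ`.  Serre proves Prop. 11 (pp. 94–96) from the behaviour of the norm on the filtration of the
units (Ch. V §6, Prop. 9 and its corollaries — the only place where completeness enters) by an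
elementary argument (Lemmas V.8–13) about the groups `V = {N x = 1}`, `W = {s(y)/y : y a unit}` and
their filtrations.  This file and its sequels (`HasseArfCyclicTwistProofs`, `HasseArfCyclicProofs`)
formalise that elementary argument in an **abstract setting**: a discrete valuation ring `S`
(the valuation ring of the complete field `L`) with an action of a finite group `G` by ring
automorphisms and a generator `s` of `G`; the norm is `∏ g, g • x`, the trace `∑ g, g • x`, the
principal units of level `n` are the `x` with `x - 1 ∈ 𝔪ⁿ`, and "`x ∈ W`" is the relation
`x u = s u` for a unit `u`.  No fields, fraction fields or completions appear; the local inputs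
(Prop. V.9, Cor. 3, Hilbert 90, residue degree one, `e = #G`) enter the final statement
`HasseArfCyclic.exists_natCast_eq_herbrandPhi_of_cyclic` as explicit hypotheses.

Contents of this file (theorems only, no definitions):

* principal units: closure of `{x : x - 1 ∈ I}` under products, inverses, powers, and the
  binomial congruences `xᵏ - 1 ≡ k (x - 1) mod Iᵐ⁺¹` for `x ≡ 1 mod Iᵐ`, `m ≥ 1`, `k ∈ ℤ`;
* the norm `∏ g, g • x` and trace `∑ g, g • x`: `G`-invariance of the trace (for the norm this
  is Mathlib's `Finset.smul_prod_perm`), multiplicativity, and for a generator `s` the reindexing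
  `∏ g, g • x = ∏_{i<#G} sⁱ • x`;
* for a DVR: `g • 𝔪ⁿ = 𝔪ⁿ`, `v(g x) = v(x)`;
* **Serre's Lemma V.9** (`exists_mul_eq_smul_of_norm_eq_one`): if `t` has non-zero trace `d` and
  `m > v(d)`, every norm-one `x ≡ 1 mod 𝔪ᵐ` is of the form `s(u)/u` — via the resolvent
  `y = ∑_{i<r} P_i(x) sⁱ(t)`, `P_i(x) = ∏_{j<i} sʲ(x)`, which satisfies `y ≡ d mod 𝔪ᵐ` and
  `x s(y) = y`.

## References

* J.-P. Serre, *Local Fields*, GTM 67, Springer 1979, Ch. V §7, Lemmas 8–9 (p. 94); Ch. IV §2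
  (the filtration `U_L^n`). [SerreLocalFields1979]
-/

noncomputable section

open IsLocalRing IsDiscreteValuationRing
open scoped Pointwise

namespace Literature.NumberTheory.GaloisRepresentations

namespace HasseArfCyclic

/-! ### Principal units `1 + I` -/

section PrincipalUnits

variable {S : Type*} [CommRing S]

/-- Product of principal units: `x - 1, y - 1 ∈ I ⇒ x y - 1 ∈ I`. [folklore] -/
theorem mul_sub_one_mem {I : Ideal S} {x y : S} (hx : x - 1 ∈ I) (hy : y - 1 ∈ I) :
    x * y - 1 ∈ I := by
  have : x * y - 1 = (x - 1) * y + (y - 1) := by ring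
  rw [this]
  exact I.add_mem (I.mul_mem_right _ hx) hy

/-- Inverse of a principal unit: `u - 1 ∈ I ⇒ u⁻¹ - 1 ∈ I`. [folklore] -/
theorem units_inv_sub_one_mem {I : Ideal S} {u : Sˣ} (hu : (u : S) - 1 ∈ I) :
    (↑u⁻¹ : S) - 1 ∈ I := by
  have : (↑u⁻¹ : S) - 1 = -(↑u⁻¹ : S) * ((u : S) - 1) := by
    have h := u.inv_mul
    linear_combination h
  rw [this]
  exact I.mul_mem_left _ hu

/-- Quotient of principal units: `x - 1, u - 1 ∈ I ⇒ x u⁻¹ - 1 ∈ I`. [folklore] -/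
theorem mul_units_inv_sub_one_mem {I : Ideal S} {x : S} {u : Sˣ} (hx : x - 1 ∈ I)
    (hu : (u : S) - 1 ∈ I) : x * ↑u⁻¹ - 1 ∈ I :=
  mul_sub_one_mem hx (units_inv_sub_one_mem hu)

/-- Powers of a principal unit. [folklore] -/
theorem pow_sub_one_mem {I : Ideal S} {x : S} (hx : x - 1 ∈ I) (k : ℕ) : x ^ k - 1 ∈ I := by
  induction k with
  | zero => simp
  | succ k ih => rw [pow_succ]; exact mul_sub_one_mem ih hx


/-- Binomial congruence for principal units: `xⁿ - 1 ≡ n (x - 1) mod Iᵐ⁺¹` when `x ≡ 1 mod Iᵐ`,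
`m ≥ 1`. [folklore] -/
theorem pow_sub_one_sub_mul_mem {I : Ideal S} {m : ℕ} (hm : 1 ≤ m) {x : S} (hx : x - 1 ∈ I ^ m)
    (n : ℕ) : x ^ n - 1 - n * (x - 1) ∈ I ^ (m + 1) := by
  have hsq : (x - 1) * (x - 1) ∈ I ^ (m + 1) := by
    have h := Ideal.mul_mem_mul hx hx
    rw [← pow_add] at h
    exact Ideal.pow_le_pow_right (by omega) h
  induction n with
  | zero => simp
  | succ n ih =>
    have : x ^ (n + 1) - 1 - ((n + 1 : ℕ) : S) * (x - 1) =
        x * (x ^ n - 1 - n * (x - 1)) + n * ((x - 1) * (x - 1)) := by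
      push_cast
      ring
    rw [this]
    exact Ideal.add_mem _ (Ideal.mul_mem_left _ _ ih) (Ideal.mul_mem_left _ _ hsq)

/-- Binomial congruence for integer powers of a principal unit:
`uᵏ - 1 ≡ k (u - 1) mod Iᵐ⁺¹` when `u ≡ 1 mod Iᵐ`, `m ≥ 1`. [folklore] -/
theorem units_zpow_sub_one_sub_mul_mem {I : Ideal S} {m : ℕ} (hm : 1 ≤ m) {u : Sˣ}
    (hu : (u : S) - 1 ∈ I ^ m) (k : ℤ) :
    ((u ^ k : Sˣ) : S) - 1 - k * ((u : S) - 1) ∈ I ^ (m + 1) := by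
  obtain ⟨n, rfl | rfl⟩ := Int.eq_nat_or_neg k
  · rw [zpow_natCast, Units.val_pow_eq_pow_val, Int.cast_natCast]
    exact pow_sub_one_sub_mul_mem hm hu n
  · set W : Sˣ := u ^ n with hW
    have hWval : (W : S) = (u : S) ^ n := by rw [hW, Units.val_pow_eq_pow_val]
    have hpos : (W : S) - 1 - n * ((u : S) - 1) ∈ I ^ (m + 1) := by
      rw [hWval]
      exact pow_sub_one_sub_mul_mem hm hu n
    have hW1 : (W : S) - 1 ∈ I ^ m := by
      rw [hWval]
      exact pow_sub_one_mem hu n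
    rw [zpow_neg, zpow_natCast, ← Ideal.mul_unit_mem_iff_mem _ (Units.isUnit W)]
    have hid : ((↑W⁻¹ : S) - 1 - ((-(n : ℤ) : ℤ) : S) * ((u : S) - 1)) * W =
        -((W : S) - 1 - n * ((u : S) - 1)) + n * (((u : S) - 1) * ((W : S) - 1)) := by
      have hinv : (↑W⁻¹ : S) * W = 1 := Units.inv_mul W
      push_cast
      linear_combination hinv
    rw [hid]
    refine Ideal.add_mem _ ((I ^ (m + 1)).neg_mem hpos) (Ideal.mul_mem_left _ _ ?_)
    have h := Ideal.mul_mem_mul hu hW1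
    rw [← pow_add] at h
    exact Ideal.pow_le_pow_right (by omega) h

/-- `x - 1 ∈ 𝔪ⁿ` with `n ≥ 1` forces `x` to be a unit of the local ring. [folklore] -/
theorem isUnit_of_sub_one_mem [IsLocalRing S] {x : S} {n : ℕ} (hn : 1 ≤ n)
    (hx : x - 1 ∈ maximalIdeal S ^ n) : IsUnit x := by
  have h1 : x - 1 ∈ maximalIdeal S := Ideal.pow_le_self (by omega) hx
  have h2 : 1 - x ∈ maximalIdeal S := by
    rw [← neg_sub]
    exact (maximalIdeal S).neg_mem h1
  have := IsLocalRing.isUnit_one_sub_self_of_mem_nonunits (1 - x)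
    ((IsLocalRing.mem_maximalIdeal _).mp h2)
  simpa using this

end PrincipalUnits

/-! ### Norm and trace sums for a finite group acting on a ring -/

section NormTrace

variable {S : Type*} [CommRing S] {G : Type*} [Group G] [Fintype G] [MulSemiringAction G S]

-- `G`-invariance of the norm (`g' • ∏ g, g • x = ∏ g, g • x`) is `Finset.smul_prod_perm x g'`.

/-- The trace `∑ g, g • x` is `G`-invariant. [folklore] -/
theorem smul_sum_smul (g' : G) (x : S) : g' • ∑ g : G, g • x = ∑ g : G, g • x := by
  rw [Finset.smul_sum]
  simp_rw [← mul_smul]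
  exact Fintype.sum_equiv (Equiv.mulLeft g') _ _ fun g => rfl

/-- The norm is multiplicative. [folklore] -/
theorem prod_smul_mul (x y : S) :
    ∏ g : G, g • (x * y) = (∏ g : G, g • x) * ∏ g : G, g • y := by
  simp_rw [smul_mul']
  exact Finset.prod_mul_distrib

/-- The norm of a translate: `N(g' x) = N(x)`. [folklore] -/
theorem prod_smul_smul (g' : G) (x : S) : ∏ g : G, g • (g' • x) = ∏ g : G, g • x := by
  simp_rw [← mul_smul]
  exact Fintype.prod_equiv (Equiv.mulRight g') _ _ fun g => rfl

variable (s : G) (hs : ∀ g : G, g ∈ Subgroup.zpowers s)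
include hs

/-- For a generator `s`: `∏ g, g • x = ∏_{i < #G} sⁱ • x`. [folklore] -/
theorem prod_smul_eq_prod_range (x : S) :
    ∏ g : G, g • x = ∏ i ∈ Finset.range (Nat.card G), s ^ i • x := by
  classical
  rw [← IsCyclic.image_range_card hs, Finset.prod_image]
  intro i hi j hj h
  rw [Finset.coe_range, Set.mem_Iio, ← orderOf_eq_card_of_forall_mem_zpowers hs] at hi hj
  exact pow_injOn_Iio_orderOf hi hj h

/-- For a generator `s`: `∑ g, g • x = ∑_{i < #G} sⁱ • x`. [folklore] -/
theorem sum_smul_eq_sum_range (x : S) :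
    ∑ g : G, g • x = ∑ i ∈ Finset.range (Nat.card G), s ^ i • x := by
  classical
  rw [← IsCyclic.image_range_card hs, Finset.sum_image]
  intro i hi j hj h
  rw [Finset.coe_range, Set.mem_Iio, ← orderOf_eq_card_of_forall_mem_zpowers hs] at hi hj
  exact pow_injOn_Iio_orderOf hi hj h

end NormTrace

/-! ### Discrete valuation rings with a group action -/

section DVR

variable {S : Type*} [CommRing S] [IsDomain S] [IsDiscreteValuationRing S]
variable {G : Type*} [Group G] [MulSemiringAction G S]

/-- `g • x ∈ 𝔪ⁿ ↔ x ∈ 𝔪ⁿ` (`g • 𝔪 = 𝔪` for a local ring). [folklore] -/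
theorem smul_mem_maximalIdeal_pow_iff (g : G) (x : S) (n : ℕ) :
    g • x ∈ maximalIdeal S ^ n ↔ x ∈ maximalIdeal S ^ n := by
  have key : ∀ (h : G) (y : S), y ∈ maximalIdeal S ^ n → h • y ∈ maximalIdeal S ^ n := by
    intro h y hy
    have : h • y ∈ h • maximalIdeal S ^ n := Ideal.smul_mem_pointwise_smul _ _ _ hy
    rwa [smul_pow', smul_maximalIdeal h] at this
  refine ⟨fun h => ?_, key g x⟩
  have := key g⁻¹ _ h
  rwa [inv_smul_smul] at this

/-- Principal units are stable under the action. [folklore] -/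
theorem smul_sub_one_mem_iff (g : G) (x : S) (n : ℕ) :
    g • x - 1 ∈ maximalIdeal S ^ n ↔ x - 1 ∈ maximalIdeal S ^ n := by
  rw [← smul_mem_maximalIdeal_pow_iff g (x - 1) n, smul_sub, smul_one]

/-- The valuation is `G`-invariant. [folklore] -/
theorem addVal_smul (g : G) (x : S) : addVal S (g • x) = addVal S x := by
  refine le_antisymm ?_ ?_
  · refine ENat.forall_natCast_le_iff_le.mp fun n hn => ?_
    rw [← mem_maximalIdeal_pow_iff_le_addVal] at hn ⊢
    exact (smul_mem_maximalIdeal_pow_iff g x n).mp hn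
  · refine ENat.forall_natCast_le_iff_le.mp fun n hn => ?_
    rw [← mem_maximalIdeal_pow_iff_le_addVal] at hn ⊢
    exact (smul_mem_maximalIdeal_pow_iff g x n).mpr hn

end DVR

/-! ### Partial norms and Serre's Lemma V.9 -/

section Lemma9

variable {S : Type*} [CommRing S] [IsDomain S] [IsDiscreteValuationRing S]
variable {G : Type*} [Group G] [Fintype G] [MulSemiringAction G S]
variable (s : G) (hs : ∀ g : G, g ∈ Subgroup.zpowers s)

omit [IsDomain S] [IsDiscreteValuationRing S] [Fintype G] in
/-- The cocycle relation of the partial norms `P_i(x) = ∏_{j<i} sʲ x`: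
`x · s(P_i(x)) = P_{i+1}(x)`. [folklore] -/
theorem mul_smul_prod_range (x : S) (i : ℕ) :
    x * s • (∏ j ∈ Finset.range i, s ^ j • x) = ∏ j ∈ Finset.range (i + 1), s ^ j • x := by
  rw [Finset.smul_prod', Finset.prod_range_succ' _ i, pow_zero, one_smul, mul_comm]
  congr 1
  refine Finset.prod_congr rfl fun j _ => ?_
  rw [← mul_smul, ← pow_succ']

omit [Fintype G] in
/-- The partial norms of a principal unit are principal units. [folklore] -/
theorem prod_range_sub_one_mem {x : S} {n : ℕ} (hx : x - 1 ∈ maximalIdeal S ^ n) (i : ℕ) :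
    (∏ j ∈ Finset.range i, s ^ j • x) - 1 ∈ maximalIdeal S ^ n := by
  induction i with
  | zero => simp
  | succ i ih =>
    rw [Finset.prod_range_succ]
    exact mul_sub_one_mem ih ((smul_sub_one_mem_iff (s ^ i) x n).mpr hx)

include hs in
/-- **Serre's Lemma V.9** (ring form).  Let `t ∈ S` have non-zero trace `d = ∑ g, g • t`, and let
`m > v(d)`.  If `x ≡ 1 mod 𝔪ᵐ` has norm `∏ g, g • x = 1`, then `x = s(u)/u` for a unit `u`
(i.e. `x u = s u`): with the "Lagrange–Hilbert resolvent" `y = ∑_{i<r} P_i(x) sⁱ(t)` one has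
`y ≡ d mod 𝔪ᵐ`, so `y = d u₀` with `u₀` a unit, and `x · s(y) = y`.
Ref: Serre, *Local Fields*, Ch. V §7, Lemma 9 (p. 94). [cite: SerreLocalFields1979, Ch. V §7 Lemma 9] -/
theorem exists_mul_eq_smul_of_norm_eq_one (t : S) (ht : ∑ g : G, g • t ≠ 0) {m : ℕ}
    (hm : addVal S (∑ g : G, g • t) < m) {x : S}
    (hx : x - 1 ∈ maximalIdeal S ^ m) (hN : ∏ g : G, g • x = 1) :
    ∃ u : S, IsUnit u ∧ x * u = s • u := by
  classical
  have hsr : s ^ Nat.card G = 1 := by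
    rw [← orderOf_eq_card_of_forall_mem_zpowers hs, pow_orderOf_eq_one]
  have hdr : ∑ g : G, g • t = ∑ i ∈ Finset.range (Nat.card G), s ^ i • t :=
    sum_smul_eq_sum_range s hs t
  have hNr : ∏ i ∈ Finset.range (Nat.card G), s ^ i • x = 1 := by
    rw [← prod_smul_eq_prod_range s hs x, hN]
  have hsd : s • ∑ g : G, g • t = ∑ g : G, g • t := smul_sum_smul s t
  -- the partial norms `P i` and the resolvent `y = ∑ F i`
  set P : ℕ → S := fun i => ∏ j ∈ Finset.range i, s ^ j • x with hP
  have hP0 : P 0 = 1 := by simp [hP]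
  have hPr : P (Nat.card G) = 1 := hNr
  have hPsucc : ∀ i, x * s • P i = P (i + 1) := fun i => mul_smul_prod_range s x i
  have hPunit : ∀ i, P i - 1 ∈ maximalIdeal S ^ m := fun i => prod_range_sub_one_mem s hx i
  set F : ℕ → S := fun i => P i * s ^ i • t with hF
  have hF0 : F 0 = t := by simp [hF, hP0]
  have hFr : F (Nat.card G) = t := by
    simp only [hF]
    rw [hPr, hsr, one_smul, one_mul]
  set d : S := ∑ g : G, g • t with hd
  set y : S := ∑ i ∈ Finset.range (Nat.card G), F i with hy
  -- (1) `y ≡ d mod 𝔪ᵐ`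
  have h1 : y - d ∈ maximalIdeal S ^ m := by
    have : y - d = ∑ i ∈ Finset.range (Nat.card G), (P i - 1) * s ^ i • t := by
      rw [hy, hdr, ← Finset.sum_sub_distrib]
      refine Finset.sum_congr rfl fun i _ => ?_
      simp only [hF]
      ring
    rw [this]
    exact Ideal.sum_mem _ fun i _ => Ideal.mul_mem_right _ _ (hPunit i)
  -- (2) `x · s(y) = y`
  have h2 : x * s • y = y := by
    have hstep : x * s • y = ∑ i ∈ Finset.range (Nat.card G), F (i + 1) := by
      rw [hy, Finset.smul_sum, Finset.mul_sum]
      refine Finset.sum_congr rfl fun i _ => ?_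
      simp only [hF]
      rw [smul_mul', ← mul_assoc, hPsucc i, ← mul_smul, ← pow_succ']
    have e1 := Finset.sum_range_succ' F (Nat.card G)
    have e2 := Finset.sum_range_succ F (Nat.card G)
    rw [hF0] at e1
    rw [hFr] at e2
    rw [hstep, hy]
    linear_combination e2 - e1
  -- (3) `y = d (1 + q)` with `q ∈ 𝔪`
  have hle : addVal S d ≤ addVal S (y - d) :=
    le_trans hm.le ((mem_maximalIdeal_pow_iff_le_addVal _ _).mp h1)
  obtain ⟨q, hq⟩ := addVal_le_iff_dvd.mp hle
  have hqm : q ∈ maximalIdeal S := by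
    by_contra hqunit
    have hqu : IsUnit q := by
      simpa [IsLocalRing.mem_maximalIdeal, mem_nonunits_iff] using hqunit
    obtain ⟨Q, hQ⟩ := hqu
    have hv : addVal S (y - d) = addVal S d := by
      rw [hq, addVal_mul, ← hQ, addVal_eq_zero_of_unit, add_zero]
    have hmle : (m : ℕ∞) ≤ addVal S (y - d) := (mem_maximalIdeal_pow_iff_le_addVal _ _).mp h1
    rw [hv] at hmle
    exact absurd (lt_of_lt_of_le hm hmle) (lt_irrefl _)
  have hu₀ : IsUnit (1 + q) :=
    isUnit_of_sub_one_mem (n := 1) le_rfl (by rw [pow_one, add_sub_cancel_left]; exact hqm)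
  have hyd : y = d * (1 + q) := by linear_combination hq
  -- (4) `x · s(1 + q) = 1 + q`, so `x = s(u)/u` with `u = (1 + q)⁻¹`
  have key : x * s • (1 + q) = 1 + q := by
    have h3 : d * (x * s • (1 + q)) = d * (1 + q) := by
      have h := h2
      rw [hyd, smul_mul', hsd] at h
      linear_combination h
    exact mul_left_cancel₀ ht h3
  have hne : s • (1 + q) ≠ 0 := by
    rw [Ne, smul_eq_zero_iff_eq]
    exact hu₀.ne_zero
  obtain ⟨U₀, hU₀⟩ := hu₀
  refine ⟨↑U₀⁻¹, Units.isUnit _, ?_⟩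
  have e1 : x * ↑U₀⁻¹ * s • (1 + q) = 1 := by
    rw [mul_right_comm, key, ← hU₀, Units.mul_inv]
  have e2 : s • (↑U₀⁻¹ : S) * s • (1 + q) = 1 := by
    rw [← smul_mul', ← hU₀, Units.inv_mul, smul_one]
  exact mul_right_cancel₀ hne (e1.trans e2.symm)

end Lemma9

end HasseArfCyclic

end Literature.NumberTheory.GaloisRepresentations

end
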